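import Mathlib

/-!
# HALF-L for `a₃` adjacent exactly to `o` and `b`: the nine-cell polynomial and its certified Bernstein form
(blind cell PercRepro2, night-1 g37; own code `mining/night-1/g37/deg2stage2.py`, `gen_poly_lean.py`)

With `a₃` attached only to `o` (weight `r₁`) and `b` (weight `r₂`), every mass of the `L`-half of (HCOV) is a
polynomial in `r₁, r₂` and the nine cells `c.XY = P₀(Q₀, o ∈ X, b ∈ Y)` (`X, Y ∈ {L, H, N}`, `L = C(a₁)`,
`H = C(a₂)`, `N` = neither) of the `(o, b)`-pattern law under `Q₀ = {a₁ ↮ a₂}` on `G′ = G − a₃` (the law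
`p[eo ↦ 0][eb ↦ 0]`): `a₃` is isolated (both edges closed), a leaf (one open) or BRIDGES `o` and `b` (both open,
killing `Q` when `o` and `b` lie in different root clusters).  `lhs = D · P(Q)² · Cov_Q(1_{bL}, Ξ_γ)` in the ten
masses `Q, bL, T, TbL, TbLoU, oH, bLoH, ToU, PD, PDoU` (`CovForm` vocabulary; `ΓLc = 2 · lhs`).

**`lhs_bern`**: `9 · lhs = Σ_{k₁,k₂} C(3,k₁) C(3,k₂) r₁^{k₁} (1−r₁)^{3−k₁} r₂^{k₂} (1−r₂)^{3−k₂} · C_{k₁k₂}(c)` — the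
(3,3)-Bernstein form, where every `C_{k₁k₂}` is an EXPLICIT nonnegative integer combination of
`cell × block` and cubic cell monomials, the blocks being the eight two-mark inequalities
`blkLL, blkHH` (BHK06 Thm 1.3 in `C(a₁)` / `C(a₂)`), `blkLLN, blkHHN` (BHK06 Thm 1.4, complemented form),
`blkM1, blkM2, blkM1o, blkM2o` (BHK06 Thm 1.4 with the avoided set {root, mark}) — all theorems of the cell.
The certificates were found by an exact Phase-1 simplex over {cell × block} ∪ {cubic monomials} (stage 2 of
p1's recipe, P1-DWORLD.md §4e) and re-verified exactly; `(3, k₂) ≡ 0`.  Consequently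
**`lhs_nonneg`**: `0 ≤ lhs` whenever the cells and the blocks are nonnegative and `r₁, r₂ ∈ [0, 1]`.
-/

namespace Summit.Ventures.PercRepro2

namespace HalfLTwoMark

/-- The nine cells of the `(o, b)`-pattern law: `XY = P₀(Q₀, o ∈ X, b ∈ Y)`. -/
structure Cells (R : Type*) where
  /-- `o ∈ L, b ∈ L` -/
  LL : R
  /-- `o ∈ L, b ∈ H` -/
  LH : R
  /-- `o ∈ L, b ∉ U` -/
  LN : R
  /-- `o ∈ H, b ∈ L` -/
  HL : R
  /-- `o ∈ H, b ∈ H` -/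
  HH : R
  /-- `o ∈ H, b ∉ U` -/
  HN : R
  /-- `o ∉ U, b ∈ L` -/
  NL : R
  /-- `o ∉ U, b ∈ H` -/
  NH : R
  /-- `o ∉ U, b ∉ U` -/
  NN : R

section Polys

variable {R : Type*} [CommRing R]

/-- The mass `P(Q)` of the instance `a₃ ~ {o, b}` in `r₁, r₂` and the cells. -/
def mQ (r₁ r₂ : R) (c : Cells R) : R :=
  c.NN + c.NH + c.NL + c.HN + c.HH + c.HL + c.LN + c.LH + c.LL - r₁ * r₂ * c.HL - r₁ * r₂ * c.LH

/-- The mass `P(Q, b ∈ L)` of the instance `a₃ ~ {o, b}` in `r₁, r₂` and the cells. -/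
def mbL (r₁ r₂ : R) (c : Cells R) : R :=
  c.NL + c.HL + c.LL - r₁ * r₂ * c.HL + r₁ * r₂ * c.LN

/-- The mass `P(T) = P(Q, a₃ ∈ H)` of the instance `a₃ ~ {o, b}` in `r₁, r₂` and the cells. -/
def mT (r₁ r₂ : R) (c : Cells R) : R :=
  r₂ * c.NH + r₂ * c.HH + r₂ * c.LH + r₁ * c.HN + r₁ * c.HH + r₁ * c.HL - r₁ * r₂ * c.HH - r₁ * r₂ * c.HL - r₁ * r₂ * c.LH

/-- The mass `P(T, b ∈ L)` of the instance `a₃ ~ {o, b}` in `r₁, r₂` and the cells. -/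
def mTbL (r₁ r₂ : R) (c : Cells R) : R :=
  r₁ * c.HL - r₁ * r₂ * c.HL

/-- The mass `P(T, b ∈ L, o ∈ U)` of the instance `a₃ ~ {o, b}` in `r₁, r₂` and the cells. -/
def mTbLoU (r₁ r₂ : R) (c : Cells R) : R :=
  r₁ * c.HL - r₁ * r₂ * c.HL

/-- The mass `P(Q, o ∈ H)` of the instance `a₃ ~ {o, b}` in `r₁, r₂` and the cells. -/
def moH (r₁ r₂ : R) (c : Cells R) : R :=
  c.HN + c.HH + c.HL + r₁ * r₂ * c.NH - r₁ * r₂ * c.HL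

/-- The mass `P(Q, b ∈ L, o ∈ H)` of the instance `a₃ ~ {o, b}` in `r₁, r₂` and the cells. -/
def mbLoH (r₁ r₂ : R) (c : Cells R) : R :=
  c.HL - r₁ * r₂ * c.HL

/-- The mass `P(T, o ∈ U)` of the instance `a₃ ~ {o, b}` in `r₁, r₂` and the cells. -/
def mToU (r₁ r₂ : R) (c : Cells R) : R :=
  r₂ * c.HH + r₂ * c.LH + r₁ * c.HN + r₁ * c.HH + r₁ * c.HL + r₁ * r₂ * c.NH - r₁ * r₂ * c.HH - r₁ * r₂ * c.HL - r₁ * r₂ * c.LH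

/-- The mass `P(PD) = P(Q, a₃ ∉ U)` of the instance `a₃ ~ {o, b}` in `r₁, r₂` and the cells. -/
def mPD (r₁ r₂ : R) (c : Cells R) : R :=
  c.NN + c.NH + c.NL + c.HN + c.HH + c.HL + c.LN + c.LH + c.LL - r₂ * c.NH - r₂ * c.NL - r₂ * c.HH - r₂ * c.HL - r₂ * c.LH - r₂ * c.LL - r₁ * c.HN - r₁ * c.HH - r₁ * c.HL - r₁ * c.LN - r₁ * c.LH - r₁ * c.LL + r₁ * r₂ * c.HH + r₁ * r₂ * c.HL + r₁ * r₂ * c.LH + r₁ * r₂ * c.LL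

/-- The mass `P(PD, o ∈ U)` of the instance `a₃ ~ {o, b}` in `r₁, r₂` and the cells. -/
def mPDoU (r₁ r₂ : R) (c : Cells R) : R :=
  c.HN + c.HH + c.HL + c.LN + c.LH + c.LL - r₂ * c.HH - r₂ * c.HL - r₂ * c.LH - r₂ * c.LL - r₁ * c.HN - r₁ * c.HH - r₁ * c.HL - r₁ * c.LN - r₁ * c.LH - r₁ * c.LL + r₁ * r₂ * c.HH + r₁ * r₂ * c.HL + r₁ * r₂ * c.LH + r₁ * r₂ * c.LL

/-- `lhs = D · P(Q)² · Cov_Q(1_{bL}, Ξ_γ)` in the ten masses: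
`Q (D (TbLoU − bLoH) − PDoU · TbL) − bL (D (ToU − oH) − PDoU · T)`. -/
def lhs (r₁ r₂ : R) (c : Cells R) : R :=
  mQ r₁ r₂ c * (mPD r₁ r₂ c * (mTbLoU r₁ r₂ c - mbLoH r₁ r₂ c) - mPDoU r₁ r₂ c * mTbL r₁ r₂ c) -
    mbL r₁ r₂ c * (mPD r₁ r₂ c * (mToU r₁ r₂ c - moH r₁ r₂ c) - mPDoU r₁ r₂ c * mT r₁ r₂ c)

/-- Block `ge_L_L`: BHK06 Thm 1.3 in `C(a₁)`: `P(Q₀, oL, bL) P(Q₀) − P(Q₀, oL) P(Q₀, bL)`. -/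
def blkLL (c : Cells R) : R :=
  -c.LN * c.NL - c.LN * c.HL - c.LH * c.NL - c.LH * c.HL + c.LL * c.NN + c.LL * c.NH + c.LL * c.HN + c.LL * c.HH

/-- Block `ge_H_H`: BHK06 Thm 1.3 in `C(a₂)`: `P(Q₀, oH, bH) P(Q₀) − P(Q₀, oH) P(Q₀, bH)`. -/
def blkHH (c : Cells R) : R :=
  -c.HN * c.NH + c.HH * c.NN + c.HH * c.NL - c.HL * c.NH + c.LN * c.HH - c.LH * c.HN - c.LH * c.HL + c.LL * c.HH

/-- Block `ge_L_LN`: BHK06 Thm 1.4 (complemented): `P(Q₀, oL, b ∉ H) P(Q₀) − P(Q₀, oL) P(Q₀, b ∉ H)`. -/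
def blkLLN (c : Cells R) : R :=
  c.LN * c.NH + c.LN * c.HH - c.LH * c.NN - c.LH * c.NL - c.LH * c.HN - c.LH * c.HL + c.LL * c.NH + c.LL * c.HH

/-- Block `ge_H_HN`: BHK06 Thm 1.4 (complemented): `P(Q₀, oH, b ∉ L) P(Q₀) − P(Q₀, oH) P(Q₀, b ∉ L)`. -/
def blkHHN (c : Cells R) : R :=
  c.HN * c.NL + c.HH * c.NL - c.HL * c.NN - c.HL * c.NH - c.LN * c.HL - c.LH * c.HL + c.LL * c.HN + c.LL * c.HH

/-- Block `M1`: BHK06 Thm 1.4 with `C(a₁)` avoiding `{a₂, b}`: `bH · LN − bN · LH`. -/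
def blkM1 (c : Cells R) : R :=
  c.LN * c.NH + c.LN * c.HH - c.LH * c.NN - c.LH * c.HN

/-- Block `M2`: BHK06 Thm 1.4 with `C(a₂)` avoiding `{a₁, b}`: `bL · HN − bN · HL`. -/
def blkM2 (c : Cells R) : R :=
  c.HN * c.NL - c.HL * c.NN - c.LN * c.HL + c.LL * c.HN

/-- Block `M1o`: BHK06 Thm 1.4 with `C(a₂)` avoiding `{a₁, o}`: `oH · NL − oN · HL`. -/
def blkM1o (c : Cells R) : R :=
  c.HN * c.NL + c.HH * c.NL - c.HL * c.NN - c.HL * c.NH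

/-- Block `M2o`: BHK06 Thm 1.4 with `C(a₁)` avoiding `{a₂, o}`: `oL · NH − oN · LH`. -/
def blkM2o (c : Cells R) : R :=
  c.LN * c.NH - c.LH * c.NN - c.LH * c.NL + c.LL * c.NH

end Polys

end HalfLTwoMark

end Summit.Ventures.PercRepro2
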